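import Literature.Computability.Complexity.PRelSigmaPi
import Literature.Computability.Complexity.CountingHierarchyProofs
import Mathlib.Tactic.DeriveFintype
import HarnessLib

/-!
# Truth-table (nonadaptive) oracle machines: `P^A` contains every polynomial-time truth-table reduction to `A`; bounded quantifiers over `P`

Trunk `CplxCore`, toolkit continuing `PRelHierarchy.lean` (free-running transcripts `trans`,
`run_eq_some_iff`) and `CookReducibilityTransitive.lean` (`P^{P^O} = P^O`, the `listBool` code of
a transcript `code_eq_boolPair`, `condFn`). A **polynomial-time truth-table reduction**
(Ladner–Lynch–Selman 1975, §3: `≤ᵖₜₜ`, "the oracle machine computes all its queries before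
receiving any answer and then evaluates a polynomial-time truth-table on the answers") is given
here by three data:

* a query generator `Q ∈ FP`: the `i`-th query on input `x` is `Q ⟨x, 1ⁱ⟩`;
* a polynomial `q`: the queries are those with `i < q(|x|)`;
* an evaluator `D ∈ P`: `x` is accepted iff `⟨x, b₀ b₁ ⋯ b_{q(|x|)-1}⟩ ∈ D`, where `bᵢ = [Q ⟨x, 1ⁱ⟩ ∈ A]`
  are the oracle's answer bits (`ttBits`).

The reduced language is `ttLang Q q D A` (`mem_ttLang_iff`). Main results:

* `ttAlg Q q D` — the oracle algorithm (`Oracle.lean`: a step function from the input and the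
  answers so far to the next query or the verdict) asking the queries in order and then deciding by
  `D`; `isPolyTime_ttAlg` — its step function is polynomial-time (a string map assembled from the
  tree's `FP` toolkit: projections of the `listBool`-coded transcript, the transducer `flatT`
  flattening the coded answer list, `condFn` on the length test `LenLt q`); `run_ttAlg`,
  `exists_of_mem_queries_ttAlg` — it decides `ttLang` within `q(|x|) + 1` rounds asking only the
  intended queries;
* **`ttLang_mem_PRel`**: `ttLang Q q D A ∈ P^A`; hence `ttLang_mem_PRelClass` (`∈ P^C` for `A ∈ C`)
  and **`ttLang_mem_P`**: for `A ∈ P` the reduced language is in `P` (`P^P = P`,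
  `PRelClass_P_subset_P`);
* the **bounded-quantifier closures of `P`** as instances (query generator `id`, evaluators given by
  two-state transducers): for `A ∈ P` and a polynomial `q` the languages
  `ballLang q A = {x | ∀ i < q(|x|), ⟨x, 1ⁱ⟩ ∈ A}`, `bexLang q A = {x | ∃ i < q(|x|), ⟨x, 1ⁱ⟩ ∈ A}` and
  `parityLang q A = {x | #{i < q(|x|) | ⟨x, 1ⁱ⟩ ∈ A} is odd}` are in `P`
  (`ballLang_mem_P`, `bexLang_mem_P`, `parityLang_mem_P`) — the loops "for `i < q(|x|)` test
  `⟨x, 1ⁱ⟩ ∈ A`" of polynomial-time algorithms (Arora–Barak 2009, §1.3), obtained without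
  programming a machine.

These are the plumbing lemmas behind `Σ₂ᵖ`-predicates with polynomially many conjuncts such as
Sipser's `Hash` predicate (Han–Hemaspaandra–Thierauf 1997, Def. 3.8; used for `PostBPP ⊆ Δ₃ᵖ`).

## References

* R. E. Ladner, N. A. Lynch, A. L. Selman, *A comparison of polynomial time reducibilities*,
  Theoret. Comput. Sci. 1 (1975) 103–123, §3 (polynomial-time truth-table reducibility `≤ᵖₜₜ`,
  and `≤ᵖₜₜ` implies `≤ᵖ_T`).
* S. Arora, B. Barak, *Computational Complexity: A Modern Approach*, CUP 2009, §3.4 (oracle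
  machines), §1.3 (polynomial time is closed under polynomially bounded loops and subroutines).
-/

namespace Literature.Computability.Complexity

open _root_.Computability Polynomial PRelSigma OracleCompose

namespace TTClosure

/-! ### Flattening the body of a coded answer list -/

/-- States of `flatT`: at an even position of the body, or after the first symbol `b` of a
symbol pair. [folklore] -/
inductive FS
  | ev
  | od (b : Bool)
  deriving DecidableEq, Fintype

/-- Transition of `flatT`. [folklore] -/
def flatStep : FS → Bool → FS × List Bool
  | FS.ev, c => (FS.od c, [])
  | FS.od b, c => (FS.ev, if b = c then [b] else [])

/-- **The flattening transducer**: on the body `⟨a₁, ⟨a₂, ⋯ ⟨a_k, ε⟩⋯⟩⟩` of a `listBool` code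
(doubled symbols `bb` inside the entries, separators `01`) it emits `a₁ a₂ ⋯ a_k` — a doubled
symbol contributes the symbol, a separator nothing. [Hopcroft–Ullman 1979, §2.7 (Moore/Mealy
machines)] [folklore] -/
def flatT : FST FS Bool Bool where
  init := FS.ev
  step := flatStep
  front := fun _ => []
  keep := fun _ => true

/-- The transition of `flatT` (definitional). [folklore] -/
@[simp] theorem flatT_step (s : FS) (c : Bool) : flatT.step s c = flatStep s c := rfl

/-- `flatT` on a doubled word emits the word. [folklore] -/
theorem flatT_run_dbl (a w : List Bool) :
    flatT.run FS.ev ((a.flatMap fun b => [b, b]) ++ w) =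
      ((flatT.run FS.ev w).1, a ++ (flatT.run FS.ev w).2) := by
  induction a with
  | nil => simp
  | cons b a ih =>
    simp only [List.flatMap_cons, List.cons_append, List.nil_append, FST.run_cons, flatT_step,
      flatStep, if_true, ih]

/-- `flatT` on the body of a coded list emits the flattened list. [folklore] -/
theorem flatT_run_body (t : List (List Bool)) : flatT.run FS.ev (body t) = (FS.ev, t.flatten) := by
  induction t with
  | nil => rfl
  | cons a t ih =>
    rw [body_cons, boolPair, List.append_assoc, flatT_run_dbl]
    simp only [List.cons_append, List.nil_append, FST.run_cons, flatT_step, flatStep, ih]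
    simp

/-- **`flatT` flattens coded lists**: `flatT (body t) = t.flatten`. [folklore] -/
theorem flatT_eval_body (t : List (List Bool)) : flatT.eval (body t) = t.flatten := by
  rw [FST.eval, show flatT.init = FS.ev from rfl, flatT_run_body]
  rfl

/-- The flattening map is in `FP`. [folklore] -/
theorem flatT_mem_FP : flatT.eval ∈ FP := flatT.polyTimeComputable_eval

/-- The one-bit transcript of `u` flattens to `u`. [folklore] -/
@[simp] theorem flatten_bitsTrans (u : List Bool) : (bitsTrans u).flatten = u := by
  induction u with
  | nil => rfl
  | cons b u ih => simp [bitsTrans, List.flatten_cons] at ih ⊢; exact ih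

/-! ### Two-state evaluators: "contains the bit `b`" and "oddly many ones" -/

/-- The transducer announcing whether the bit `b` occurs: state = seen so far; it emits nothing
and prepends `[seen]`. [Hopcroft–Ullman 1979, §2.7] [folklore] -/
def hasBitT (b : Bool) : FST Bool Bool Bool where
  init := false
  step s c := (s || decide (c = b), [])
  front s := [s]
  keep _ := false

/-- The transition of `hasBitT` (definitional). [folklore] -/
@[simp] theorem hasBitT_step (b s c : Bool) : (hasBitT b).step s c = (s || decide (c = b), []) := rfl

/-- The run of `hasBitT`. [folklore] -/
theorem hasBitT_run (b : Bool) (s : Bool) (w : List Bool) :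
    (hasBitT b).run s w = (s || decide (b ∈ w), []) := by
  induction w generalizing s with
  | nil => simp
  | cons c w ih =>
    rw [FST.run_cons, hasBitT_step, ih]
    simp only [List.mem_cons, List.append_nil, Prod.mk.injEq, and_true]
    cases s <;> cases b <;> cases c <;> simp

/-- **`hasBitT b` decides occurrence of `b`**: `hasBitT b w = [decide (b ∈ w)]`. [folklore] -/
theorem hasBitT_eval (b : Bool) (w : List Bool) : (hasBitT b).eval w = [decide (b ∈ w)] := by
  rw [FST.eval, show (hasBitT b).init = false from rfl, hasBitT_run]
  simp [hasBitT]

/-- The language of strings containing the bit `b`. [folklore] -/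
def HasBit (b : Bool) : Language Bool := {w | b ∈ w}

/-- Membership in `HasBit`. [folklore] -/
@[simp] theorem mem_HasBit {b : Bool} {w : List Bool} : w ∈ HasBit b ↔ b ∈ w := Iff.rfl

/-- `HasBit b ∈ P` (a two-state transducer decides it). [folklore] -/
theorem HasBit_mem_P (b : Bool) : HasBit b ∈ Classes.P :=
  mem_P_of_mem_FP (hasBitT b).polyTimeComputable_eval _ fun w =>
    ⟨fun h => by rw [hasBitT_eval]; simpa using h, fun h => by rw [hasBitT_eval]; simpa using h⟩

/-- The language of strings avoiding the bit `b` (the complement of `HasBit b`). [folklore] -/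
def NoBit (b : Bool) : Language Bool := {w | b ∉ w}

/-- Membership in `NoBit`. [folklore] -/
@[simp] theorem mem_NoBit {b : Bool} {w : List Bool} : w ∈ NoBit b ↔ b ∉ w := Iff.rfl

/-- `NoBit b ∈ P` (complement of `HasBit b`; `P` is closed under complement). [folklore] -/
theorem NoBit_mem_P (b : Bool) : NoBit b ∈ Classes.P :=
  (compl_mem_P_iff (L := HasBit b)).2 (HasBit_mem_P b)

/-- The transducer announcing the parity of the number of ones: state = parity so far.
[Hopcroft–Ullman 1979, §2.7] [folklore] -/
def parityT : FST Bool Bool Bool where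
  init := false
  step s c := (xor s c, [])
  front s := [s]
  keep _ := false

/-- The transition of `parityT` (definitional). [folklore] -/
@[simp] theorem parityT_step (s c : Bool) : parityT.step s c = (xor s c, []) := rfl

/-- The run of `parityT`. [folklore] -/
theorem parityT_run (s : Bool) (w : List Bool) :
    parityT.run s w = (xor s (decide (Odd (w.count true))), []) := by
  induction w generalizing s with
  | nil => simp
  | cons c w ih =>
    rw [FST.run_cons, parityT_step, ih, List.count_cons]
    rcases c with _ | _
    · simp
    · have h : decide (Odd (List.count true w + 1)) = !decide (Odd (List.count true w)) := by
        by_cases ho : Odd (List.count true w)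
        · simp [ho, Nat.odd_add_one]
        · simp [ho, Nat.odd_add_one]
      simp only [beq_self_eq_true, if_true, h, List.append_nil, Prod.mk.injEq, and_true]
      cases s <;> cases decide (Odd (List.count true w)) <;> rfl

/-- **`parityT` decides the parity of the number of ones**: `parityT w = [decide (Odd (count 1 w))]`.
[folklore] -/
theorem parityT_eval (w : List Bool) : parityT.eval w = [decide (Odd (w.count true))] := by
  rw [FST.eval, show parityT.init = false from rfl, parityT_run]
  simp [parityT]

/-- The language of strings with an odd number of ones. [folklore] -/
def OddOnes : Language Bool := {w | Odd (w.count true)}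

/-- Membership in `OddOnes`. [folklore] -/
@[simp] theorem mem_OddOnes {w : List Bool} : w ∈ OddOnes ↔ Odd (w.count true) := Iff.rfl

/-- `OddOnes ∈ P`. [folklore] -/
theorem OddOnes_mem_P : OddOnes ∈ Classes.P :=
  mem_P_of_mem_FP parityT.polyTimeComputable_eval _ fun w =>
    ⟨fun h => by rw [parityT_eval]; simpa using h, fun h => by rw [parityT_eval]; simpa using h⟩

end TTClosure

open TTClosure

/-! ### The truth-table reduction and its oracle algorithm -/

section TT

variable (Q : List Bool → List Bool) (q : Polynomial ℕ) (D : Language Bool)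

/-- The answer bits of the first `n` queries: `[Q ⟨x, 1⁰⟩ ∈ A], …, [Q ⟨x, 1ⁿ⁻¹⟩ ∈ A]`.
[Ladner–Lynch–Selman 1975, §3] [cite: LadnerLynchSelman1975, §3] -/
noncomputable def ttBits (A : Language Bool) (x : List Bool) (n : ℕ) : List Bool :=
  (List.range n).map fun i => A.boolIndicator (Q (boolPair x (List.replicate i true)))

/-- **The language truth-table reduced to `A`** by the queries `Q ⟨x, 1ⁱ⟩`, `i < q(|x|)`, and the
evaluator `D`: `x` is a member iff `⟨x, answer bits⟩ ∈ D`. [Ladner–Lynch–Selman 1975, §3 (`≤ᵖₜₜ`: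
a tt-condition generator and evaluator)] [cite: LadnerLynchSelman1975, §3] -/
def ttLang (A : Language Bool) : Language Bool :=
  {x | boolPair x (ttBits Q A x (q.eval x.length)) ∈ D}

/-- **The truth-table oracle algorithm**: while fewer than `q(|x|)` answers have been received, ask
`Q ⟨x, 1^{#answers}⟩`; then output `[⟨x, answers⟩ ∈ D]` (the answers, one-bit strings for a
language oracle, flattened to a bit string). [Ladner–Lynch–Selman 1975, §3 ("≤ᵖₜₜ implies ≤ᵖ_T")]
[cite: LadnerLynchSelman1975, §3] -/
noncomputable def ttAlg : OracleAlg Bool where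
  step x ans :=
    if ans.length < q.eval x.length then Sum.inl (Q (boolPair x (List.replicate ans.length true)))
    else Sum.inr (D.boolIndicator (boolPair x ans.flatten))

variable {Q q D}

/-- `ttBits` has `n` entries. [folklore] -/
@[simp] theorem length_ttBits (A : Language Bool) (x : List Bool) (n : ℕ) :
    (ttBits Q A x n).length = n := by
  simp [ttBits]

/-- One more answer bit. [folklore] -/
theorem ttBits_succ (A : Language Bool) (x : List Bool) (n : ℕ) :
    ttBits Q A x (n + 1) = ttBits Q A x n ++ [A.boolIndicator (Q (boolPair x (List.replicate n true)))] := by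
  simp [ttBits, List.range_succ]

/-- The `i`-th answer bit. [folklore] -/
theorem getElem_ttBits (A : Language Bool) (x : List Bool) {n i : ℕ}
    (h : i < (ttBits Q A x n).length) :
    (ttBits Q A x n)[i] = A.boolIndicator (Q (boolPair x (List.replicate i true))) := by
  simp [ttBits, List.getElem_range]

/-- Membership in the answer bits: `(ttBits…)[i] = true ↔ Q ⟨x, 1ⁱ⟩ ∈ A`. [folklore] -/
theorem getElem_ttBits_eq_true_iff (A : Language Bool) (x : List Bool) {n i : ℕ}
    (h : i < (ttBits Q A x n).length) :
    (ttBits Q A x n)[i] = true ↔ Q (boolPair x (List.replicate i true)) ∈ A := by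
  rw [getElem_ttBits A x h]
  constructor
  · intro h1
    by_contra h2
    rw [(Set.notMem_iff_boolIndicator _ _).1 h2] at h1
    exact Bool.false_ne_true h1
  · intro h1
    exact (Set.mem_iff_boolIndicator _ _).1 h1

/-- Unfolding lemma for `ttLang`. [Ladner–Lynch–Selman 1975, §3] [cite: LadnerLynchSelman1975, §3] -/
theorem mem_ttLang_iff {A : Language Bool} {x : List Bool} :
    x ∈ ttLang Q q D A ↔ boolPair x (ttBits Q A x (q.eval x.length)) ∈ D :=
  Iff.rfl

/-- The step of `ttAlg` before the last query has been answered is the next query. [folklore] -/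
theorem ttAlg_step_of_lt (x : List Bool) {ans : List (List Bool)} (h : ans.length < q.eval x.length) :
    (ttAlg Q q D).step x ans = Sum.inl (Q (boolPair x (List.replicate ans.length true))) := by
  simp [ttAlg, h]

/-- The step of `ttAlg` after all answers is the verdict. [folklore] -/
theorem ttAlg_step_of_le (x : List Bool) {ans : List (List Bool)} (h : q.eval x.length ≤ ans.length) :
    (ttAlg Q q D).step x ans = Sum.inr (D.boolIndicator (boolPair x ans.flatten)) := by
  simp [ttAlg, Nat.not_lt.2 h]

/-- **The transcript of `ttAlg` is the list of intended answer bits.** [folklore] -/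
theorem trans_ttAlg (A : Language Bool) (x : List Bool) :
    ∀ i ≤ q.eval x.length, trans (ttAlg Q q D) (Oracle.ofLanguage A) x i = bitsTrans (ttBits Q A x i)
  | 0, _ => by simp [ttBits]
  | i + 1, hi => by
    have ih := trans_ttAlg A x i (Nat.le_of_succ_le hi)
    rw [trans_succ, ih, qryOf_eq_of_step_eq (ttAlg_step_of_lt x (by simpa using hi)),
      ofLanguage_eq_singleton, ttBits_succ, bitsTrans_append, bitsTrans_singleton, length_bitsTrans,
      length_ttBits]

/-- **`ttAlg` decides `ttLang`** within any budget of more than `q(|x|)` rounds. [Ladner–Lynch–Selman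
1975, §3] [cite: LadnerLynchSelman1975, §3] -/
theorem run_ttAlg (A : Language Bool) (x : List Bool) {n : ℕ} (hn : q.eval x.length < n) :
    (ttAlg Q q D).run (Oracle.ofLanguage A) n x = some ((ttLang Q q D A).boolIndicator x) := by
  rw [run_eq_some_iff]
  refine ⟨q.eval x.length, hn, fun i hi => ⟨Q (boolPair x (List.replicate i true)), ?_⟩, ?_⟩
  · rw [trans_ttAlg A x i hi.le, ttAlg_step_of_lt x (by simpa using hi), length_bitsTrans, length_ttBits]
  · rw [trans_ttAlg A x _ le_rfl, ttAlg_step_of_le x (by simp), flatten_bitsTrans]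
    rfl

/-- **The queries of `ttAlg` are the intended ones**: every recorded query is `Q ⟨x, 1ⁱ⟩` for some
`i < q(|x|)`. [folklore] -/
theorem exists_of_mem_queries_ttAlg (A : Language Bool) (x : List Bool) {n : ℕ} {y : List Bool}
    (hy : y ∈ (ttAlg Q q D).queries (Oracle.ofLanguage A) n x) :
    ∃ i < q.eval x.length, y = Q (boolPair x (List.replicate i true)) := by
  obtain ⟨i, -, hall, rfl⟩ := exists_of_mem_queries _ _ n x y hy
  -- all rounds `≤ i` are queries, so `i < q(|x|)`
  have hi : i < q.eval x.length := by
    by_contra hle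
    obtain ⟨y', hy'⟩ := hall (q.eval x.length) (Nat.not_lt.1 hle)
    rw [trans_ttAlg A x _ le_rfl, ttAlg_step_of_le x (by simp)] at hy'
    cases hy'
  refine ⟨i, hi, ?_⟩
  rw [trans_ttAlg A x i hi.le, qryOf_eq_of_step_eq (ttAlg_step_of_lt x (by simpa using hi)),
    length_bitsTrans, length_ttBits]

/-! ### The step function of `ttAlg` as a string map -/

/-- The unary count `1^{#answers}` read off the coded pair `⟨x, ⟨1^{#answers}, body⟩⟩`. [folklore] -/
def cntA : List Bool → List Bool := fstP ∘ sndP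

/-- The body of the coded answer list read off `⟨x, ⟨1^{#answers}, body⟩⟩`. [folklore] -/
def bodA : List Bool → List Bool := sndP ∘ sndP

/-- `cntA ∈ FP`. [folklore] -/
theorem cntA_mem_FP : cntA ∈ FP := comp_mem_FP fstP_mem_FP sndP_mem_FP

/-- `bodA ∈ FP`. [folklore] -/
theorem bodA_mem_FP : bodA ∈ FP := comp_mem_FP sndP_mem_FP sndP_mem_FP

variable (Q q D)

/-- The code `0 · Q ⟨x, 1^{#answers}⟩` of the next query. [folklore] -/
noncomputable def qryS : List Bool → List Bool := List.cons false ∘ Q ∘ pairFn fstP cntA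

/-- The code `1 · [⟨x, flattened answers⟩ ∈ D]` of the verdict. [folklore] -/
noncomputable def decS : List Bool → List Bool :=
  List.cons true ∘ (fun w => encodeBool (D.boolIndicator w)) ∘ pairFn fstP (flatT.eval ∘ bodA)

/-- The guard "fewer than `q(|x|)` answers so far". [folklore] -/
noncomputable def GoOn : Language Bool := pairFn fstP cntA ⁻¹' LenLt q

/-- **The step function of `ttAlg` as a string map.** [folklore] -/
noncomputable def stepS : List Bool → List Bool := condFn (GoOn q) (qryS Q) (decS D)

variable {Q q D}

/-- `qryS Q ∈ FP` for `Q ∈ FP`. [folklore] -/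
theorem qryS_mem_FP (hQ : Q ∈ FP) : qryS Q ∈ FP :=
  comp_mem_FP (cons_mem_FP false) (comp_mem_FP hQ (pairFn_mem_FP fstP_mem_FP cntA_mem_FP))

/-- `decS D ∈ FP` for `D ∈ P`. [folklore] -/
theorem decS_mem_FP (hD : D ∈ Classes.P) : decS D ∈ FP :=
  comp_mem_FP (cons_mem_FP true) (comp_mem_FP (indicatorFn_mem_FP hD)
    (pairFn_mem_FP fstP_mem_FP (comp_mem_FP flatT_mem_FP bodA_mem_FP)))

/-- `GoOn q ∈ P`. [folklore] -/
theorem GoOn_mem_P (q : Polynomial ℕ) : GoOn q ∈ Classes.P :=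
  preimage_mem_P (LenLt_mem_P q) (pairFn_mem_FP fstP_mem_FP cntA_mem_FP)

/-- **`stepS ∈ FP`.** [folklore] -/
theorem stepS_mem_FP (hQ : Q ∈ FP) (hD : D ∈ Classes.P) : stepS Q q D ∈ FP :=
  condFn_mem_FP (GoOn_mem_P q) (qryS_mem_FP hQ) (decS_mem_FP hD)

/-- The accessors on a coded pair. [folklore] -/
theorem cntA_apply (x : List Bool) (ans : List (List Bool)) :
    cntA (boolPair x ((encodingList Bool).listBool.encode ans)) = List.replicate ans.length true := by
  simp [cntA, fstP, sndP, code_eq_boolPair]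

/-- The accessors on a coded pair. [folklore] -/
theorem bodA_apply (x : List Bool) (ans : List (List Bool)) :
    bodA (boolPair x ((encodingList Bool).listBool.encode ans)) = body ans := by
  simp [bodA, sndP, code_eq_boolPair]

/-- Membership in a preimage, for the `Language` membership instance (definitional; Mathlib's
`Set.mem_preimage` does not fire on `Language`-typed goals). [folklore] -/
theorem memL_preimage {f : List Bool → List Bool} {L : Language Bool} {w : List Bool} :
    @Membership.mem (List Bool) (Language Bool) _ (f ⁻¹' L) w ↔ f w ∈ L := Iff.rfl

/-- Reading the guard. [folklore] -/
theorem mem_GoOn_iff (x : List Bool) (ans : List (List Bool)) :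
    boolPair x ((encodingList Bool).listBool.encode ans) ∈ GoOn q ↔ ans.length < q.eval x.length := by
  unfold GoOn
  rw [memL_preimage, pairFn_apply, cntA_apply, fstP_boolPair, boolPair_mem_LenLt, List.length_replicate]

/-- The query branch computes the query code. [folklore] -/
theorem qryS_apply (x : List Bool) (ans : List (List Bool)) :
    qryS Q (boolPair x ((encodingList Bool).listBool.encode ans)) =
      false :: Q (boolPair x (List.replicate ans.length true)) := by
  rw [qryS, Function.comp_apply, Function.comp_apply, pairFn_apply, cntA_apply, fstP_boolPair]

/-- The verdict branch computes the verdict code. [folklore] -/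
theorem decS_apply (x : List Bool) (ans : List (List Bool)) :
    decS D (boolPair x ((encodingList Bool).listBool.encode ans)) =
      [true, D.boolIndicator (boolPair x ans.flatten)] := by
  rw [decS, Function.comp_apply, Function.comp_apply, pairFn_apply, fstP_boolPair, Function.comp_apply,
    bodA_apply, flatT_eval_body]
  rfl

/-- **The string map computes the step function.** [folklore] -/
theorem stepS_apply (x : List Bool) (ans : List (List Bool)) :
    stepS Q q D (boolPair x ((encodingList Bool).listBool.encode ans)) =
      stepCode ((ttAlg Q q D).step x ans) := by
  by_cases h : ans.length < q.eval x.length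
  · rw [stepS, condFn_of_mem _ _ ((mem_GoOn_iff x ans).2 h), ttAlg_step_of_lt x h, qryS_apply,
      stepCode_inl]
  · rw [stepS, condFn_of_not_mem _ _ (fun h' => h ((mem_GoOn_iff x ans).1 h')),
      ttAlg_step_of_le x (Nat.not_lt.1 h), decS_apply, stepCode_inr]

/-- **`ttAlg` is polynomial-time** for `Q ∈ FP` and `D ∈ P`. [Ladner–Lynch–Selman 1975, §3;
Arora–Barak 2009, §3.4] [cite: LadnerLynchSelman1975, §3] -/
theorem isPolyTime_ttAlg (hQ : Q ∈ FP) (hD : D ∈ Classes.P) : (ttAlg Q q D).IsPolyTime encodingBoolBool := by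
  obtain ⟨p, Mx, h⟩ := stepS_mem_FP (q := q) hQ hD
  refine ⟨p, Mx, fun z => ?_⟩
  have hz := h (boolPair z.1 ((encodingList Bool).listBool.encode z.2))
  rw [id, stepS_apply] at hz
  exact hz

/-! ### Main results -/

/-- The resource polynomial of `ttAlg`: rounds `q + 1` and query lengths `s(2n + 2 + q n)` for an
output-length bound `s` of `Q`. [folklore] -/
noncomputable def ttBudget (q s : Polynomial ℕ) : Polynomial ℕ := q + 1 + s.comp (2 * X + 2 + q)

/-- Evaluation of `ttBudget`. [folklore] -/
theorem ttBudget_eval (q s : Polynomial ℕ) (n : ℕ) :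
    (ttBudget q s).eval n = q.eval n + 1 + s.eval (2 * n + 2 + q.eval n) := by
  simp [ttBudget, eval_comp]

/-- **Truth-table reductions are Turing reductions**: `ttLang Q q D A ∈ P^A` for `Q ∈ FP`, `D ∈ P`.
(Ladner–Lynch–Selman 1975, §3: `A ≤ᵖₜₜ B` implies `A ≤ᵖ_T B`.) [cite: LadnerLynchSelman1975, §3] -/
theorem ttLang_mem_PRel (hQ : Q ∈ FP) (hD : D ∈ Classes.P) (A : Language Bool) :
    ttLang Q q D A ∈ PRel (Oracle.ofLanguage A) := by
  obtain ⟨s, hs⟩ := exists_poly_length_le_of_mem_FP hQ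
  refine ⟨ttAlg Q q D, isPolyTime_ttAlg hQ hD, ttBudget q s, fun x => ⟨?_, fun y hy => ?_⟩⟩
  · exact run_ttAlg A x (by rw [ttBudget_eval]; omega)
  · obtain ⟨i, hi, rfl⟩ := exists_of_mem_queries_ttAlg A x hy
    refine (hs _).trans ?_
    rw [ttBudget_eval, length_boolPair, List.length_replicate]
    exact (TM2Iter.eval_mono s (by omega)).trans (Nat.le_add_left _ _)

/-- `ttLang Q q D A ∈ P^C` for `A ∈ C`. [Ladner–Lynch–Selman 1975, §3] [cite: LadnerLynchSelman1975, §3] -/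
theorem ttLang_mem_PRelClass (hQ : Q ∈ FP) (hD : D ∈ Classes.P) {C : Set (Language Bool)} {A : Language Bool}
    (hA : A ∈ C) : ttLang Q q D A ∈ PRelClass C :=
  mem_PRelClass_iff.2 ⟨A, hA, ttLang_mem_PRel hQ hD A⟩

/-- **`P` is closed under polynomial-time truth-table reductions**: `ttLang Q q D A ∈ P` for
`Q ∈ FP`, `D ∈ P`, `A ∈ P` (`P^P = P`). [Ladner–Lynch–Selman 1975, §3; Arora–Barak 2009, §1.3]
[cite: LadnerLynchSelman1975, §3] -/
theorem ttLang_mem_P (hQ : Q ∈ FP) (hD : D ∈ Classes.P) {A : Language Bool} (hA : A ∈ Classes.P) :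
    ttLang Q q D A ∈ Classes.P :=
  PRelClass_P_subset_P (ttLang_mem_PRelClass hQ hD hA)

end TT

/-! ### Bounded quantifiers over `P` -/

section Bounded

variable (q : Polynomial ℕ) (A : Language Bool)

/-- `ballLang q A = {x | ∀ i < q(|x|), ⟨x, 1ⁱ⟩ ∈ A}` — a polynomially bounded universal quantifier.
[Arora–Barak 2009, §1.3 (loops of polynomial length)] [folklore] -/
def ballLang : Language Bool := {x | ∀ i < q.eval x.length, boolPair x (List.replicate i true) ∈ A}

/-- `bexLang q A = {x | ∃ i < q(|x|), ⟨x, 1ⁱ⟩ ∈ A}` — a polynomially bounded existential quantifier.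
[Arora–Barak 2009, §1.3] [folklore] -/
def bexLang : Language Bool := {x | ∃ i < q.eval x.length, boolPair x (List.replicate i true) ∈ A}

/-- `parityLang q A = {x | #{i < q(|x|) | ⟨x, 1ⁱ⟩ ∈ A} is odd}` — a polynomially bounded parity
quantifier (arithmetic in `GF(2)`; the count is `Set.ncard`, no decidability needed).
[Arora–Barak 2009, §1.3] [folklore] -/
def parityLang : Language Bool :=
  {x | Odd (Set.ncard {i : ℕ | i < q.eval x.length ∧ boolPair x (List.replicate i true) ∈ A})}

variable {q A}

/-- Membership in `ballLang`. [folklore] -/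
@[simp] theorem mem_ballLang {x : List Bool} :
    x ∈ ballLang q A ↔ ∀ i < q.eval x.length, boolPair x (List.replicate i true) ∈ A := Iff.rfl

/-- Membership in `bexLang`. [folklore] -/
@[simp] theorem mem_bexLang {x : List Bool} :
    x ∈ bexLang q A ↔ ∃ i < q.eval x.length, boolPair x (List.replicate i true) ∈ A := Iff.rfl

/-- Membership in `parityLang`. [folklore] -/
@[simp] theorem mem_parityLang {x : List Bool} :
    x ∈ parityLang q A ↔
      Odd (Set.ncard {i : ℕ | i < q.eval x.length ∧ boolPair x (List.replicate i true) ∈ A}) :=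
  Iff.rfl

/-- The counted set of `parityLang` as a filtered range (for counting with `Finset.card`).
[folklore] -/
theorem ncard_setOf_lt_and (n : ℕ) (p : ℕ → Prop) [DecidablePred p] :
    Set.ncard {i : ℕ | i < n ∧ p i} = ((Finset.range n).filter p).card := by
  rw [← Set.ncard_coe_finset]
  congr 1
  ext i
  simp

/-- With the identity as query generator the answer bits are the membership bits of `⟨x, 1ⁱ⟩`.
[folklore] -/
theorem mem_ttBits_id_iff (x : List Bool) (n : ℕ) (b : Bool) :
    b ∈ ttBits id A x n ↔ ∃ i < n, A.boolIndicator (boolPair x (List.replicate i true)) = b := by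
  simp [ttBits]

/-- The indicator is `true` iff membership. [folklore] -/
theorem boolIndicator_eq_true_iff' (L : Language Bool) (w : List Bool) :
    L.boolIndicator w = true ↔ w ∈ L :=
  ⟨fun h => by
    by_contra h2
    rw [(Set.notMem_iff_boolIndicator _ _).1 h2] at h
    exact Bool.false_ne_true h, fun h => (Set.mem_iff_boolIndicator _ _).1 h⟩

/-- The indicator is `false` iff non-membership. [folklore] -/
theorem boolIndicator_eq_false_iff' (L : Language Bool) (w : List Bool) :
    L.boolIndicator w = false ↔ w ∉ L := by
  rw [← boolIndicator_eq_true_iff', Bool.eq_false_iff]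

/-- `ballLang` as a truth-table reduction: no answer bit is `0`. [folklore] -/
theorem ballLang_eq_ttLang : ballLang q A = ttLang id q (sndP ⁻¹' NoBit false) A := by
  ext x
  rw [mem_ttLang_iff, memL_preimage, mem_NoBit, mem_ballLang, sndP_boolPair, mem_ttBits_id_iff]
  simp only [not_exists, not_and, boolIndicator_eq_false_iff', not_not]

/-- `bexLang` as a truth-table reduction: some answer bit is `1`. [folklore] -/
theorem bexLang_eq_ttLang : bexLang q A = ttLang id q (sndP ⁻¹' HasBit true) A := by
  ext x
  rw [mem_ttLang_iff, memL_preimage, mem_bexLang, sndP_boolPair, mem_HasBit, mem_ttBits_id_iff]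
  simp only [boolIndicator_eq_true_iff']

/-- The number of ones among the answer bits is the number of members (counted over a filtered
range). [folklore] -/
theorem count_true_ttBits_id_eq_card (x : List Bool) (p : ℕ → Prop) [DecidablePred p]
    (hp : ∀ i, p i ↔ boolPair x (List.replicate i true) ∈ A) :
    ∀ n : ℕ, (ttBits id A x n).count true = ((Finset.range n).filter p).card
  | 0 => by simp [ttBits]
  | n + 1 => by
    rw [ttBits_succ, List.count_append, count_true_ttBits_id_eq_card x p hp n, Finset.range_add_one,
      Finset.filter_insert]
    by_cases hn : boolPair x (List.replicate n true) ∈ A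
    · have hb : A.boolIndicator (id (boolPair x (List.replicate n true))) = true :=
        (boolIndicator_eq_true_iff' A _).2 hn
      rw [if_pos ((hp n).2 hn), Finset.card_insert_of_notMem (by simp), hb]
      simp
    · have hb : A.boolIndicator (id (boolPair x (List.replicate n true))) = false :=
        (boolIndicator_eq_false_iff' A _).2 hn
      rw [if_neg (fun h => hn ((hp n).1 h)), hb]
      simp

/-- The number of ones among the answer bits is the number of members. [folklore] -/
theorem count_true_ttBits_id (x : List Bool) (n : ℕ) :
    (ttBits id A x n).count true =
      Set.ncard {i : ℕ | i < n ∧ boolPair x (List.replicate i true) ∈ A} := by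
  classical
  rw [ncard_setOf_lt_and, count_true_ttBits_id_eq_card x _ (fun i => Iff.rfl) n]

/-- `parityLang` as a truth-table reduction: oddly many answer bits are `1`. [folklore] -/
theorem parityLang_eq_ttLang : parityLang q A = ttLang id q (sndP ⁻¹' OddOnes) A := by
  ext x
  rw [mem_ttLang_iff, memL_preimage, mem_parityLang, sndP_boolPair, mem_OddOnes, count_true_ttBits_id]

/-- **`P` is closed under polynomially bounded `∀`**: `ballLang q A ∈ P` for `A ∈ P`.
[Arora–Barak 2009, §1.3] [folklore] -/
theorem ballLang_mem_P (q : Polynomial ℕ) {A : Language Bool} (hA : A ∈ Classes.P) : ballLang q A ∈ Classes.P := by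
  rw [ballLang_eq_ttLang]
  exact ttLang_mem_P id_mem_FP (preimage_mem_P (NoBit_mem_P false) sndP_mem_FP) hA

/-- **`P` is closed under polynomially bounded `∃`**: `bexLang q A ∈ P` for `A ∈ P`.
[Arora–Barak 2009, §1.3] [folklore] -/
theorem bexLang_mem_P (q : Polynomial ℕ) {A : Language Bool} (hA : A ∈ Classes.P) : bexLang q A ∈ Classes.P := by
  rw [bexLang_eq_ttLang]
  exact ttLang_mem_P id_mem_FP (preimage_mem_P (HasBit_mem_P true) sndP_mem_FP) hA

/-- **`P` is closed under polynomially bounded parity quantification**: `parityLang q A ∈ P` for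
`A ∈ P`. [Arora–Barak 2009, §1.3] [folklore] -/
theorem parityLang_mem_P (q : Polynomial ℕ) {A : Language Bool} (hA : A ∈ Classes.P) : parityLang q A ∈ Classes.P := by
  rw [parityLang_eq_ttLang]
  exact ttLang_mem_P id_mem_FP (preimage_mem_P OddOnes_mem_P sndP_mem_FP) hA

/-- `ballLang q A ∈ P^C` for `A ∈ C`. [folklore] -/
theorem ballLang_mem_PRelClass (q : Polynomial ℕ) {C : Set (Language Bool)} {A : Language Bool}
    (hA : A ∈ C) : ballLang q A ∈ PRelClass C := by
  rw [ballLang_eq_ttLang]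
  exact ttLang_mem_PRelClass id_mem_FP (preimage_mem_P (NoBit_mem_P false) sndP_mem_FP) hA

/-- `bexLang q A ∈ P^C` for `A ∈ C`. [folklore] -/
theorem bexLang_mem_PRelClass (q : Polynomial ℕ) {C : Set (Language Bool)} {A : Language Bool}
    (hA : A ∈ C) : bexLang q A ∈ PRelClass C := by
  rw [bexLang_eq_ttLang]
  exact ttLang_mem_PRelClass id_mem_FP (preimage_mem_P (HasBit_mem_P true) sndP_mem_FP) hA

end Bounded

end Literature.Computability.Complexity
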